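import Summits.RiemannHypothesis.RiemannHypothesis.Theorems.WeilTwoPrimeDeflE25EBase
import Summits.RiemannHypothesis.RiemannHypothesis.Theorems.WeilTwoPrimeDeflE25EDataR
import Summits.RiemannHypothesis.RiemannHypothesis.Theorems.WeilTwoPrimeDeflE25ODataNu
import Literature.NumberTheory.LFunctions.WeilTwoPrimeCellsT120
import Literature.NumberTheory.LFunctions.WeilTwoPrimeCertificateDeflated
import HarnessLib

/-!
# Even-sector deflated two-prime certificate E25E: the certificate `weilCertDeflE25E : WeilCert23` and its augmented coefficient matrix

`weilCertDeflE25E` = base `weilCertDeflE25EBase` + `j = 5` + `pnu = 64` + the cells `weilTwoPrimeCellsT120` + support `b = 10059/12500` + the moment table `weilCertDeflE25ONu` of certificate E25O (same `a₀`, `N`: identical table, reused by name); penalty data `weilCertDeflE25ER`; `weilCertDeflE25EP = P_r + Σ μ ĉ ĉᵀ`. [cite: Yoshida1992, §6, Thm 1 p. 310] Data only.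
-/

set_option linter.dupNamespace false

noncomputable section

namespace Summit.RiemannHypothesis.RiemannHypothesis.Theorems.EvenWinsBeyondArch

open Literature.NumberTheory.LFunctions

/-- **The even-sector deflated two-prime certificate E25E** (`a₀ = b = 10059/12500`, `N = 271`, `T = 120`, `β₂₃ = 17/25`, k_even = 6). [folklore] -/
def weilCertDeflE25E : WeilCert23 := ⟨weilCertDeflE25EBase, 5, 64, weilTwoPrimeCellsT120, 10059/12500, weilCertDeflE25ONu⟩

/-- The base of `weilCertDeflE25E` is `weilCertDeflE25EBase` (definitional). [folklore] -/
theorem weilCertDeflE25E_base : weilCertDeflE25E.base = weilCertDeflE25EBase := rfl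

/-- The table of `weilCertDeflE25E` is `weilCertDeflE25ONu` (definitional). [folklore] -/
theorem weilCertDeflE25E_nuTab : weilCertDeflE25E.nuTab = weilCertDeflE25ONu := rfl

/-- The augmented coefficient matrix `P_r + Σ μ ĉ ĉᵀ` of certificate E25E. [folklore] -/
def weilCertDeflE25EP (k l : ℕ) : ℚ := weilCertDeflE25EBase.prQ weilCertDeflE25ONu k l + rankOneQ weilCertDeflE25ER k l

/-- `weilCertDeflE25EP` is the augmented matrix of the certificate (definitional). [folklore] -/
theorem weilCertDeflE25EP_eq : weilCertDeflE25EP = fun k l ↦ weilCertDeflE25E.base.prQ weilCertDeflE25E.nuTab k l + rankOneQ weilCertDeflE25ER k l := rfl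

end Summit.RiemannHypothesis.RiemannHypothesis.Theorems.EvenWinsBeyondArch
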